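import Summits.QuantumFields.YangMills.Theorems.UnitScaleTiltProp7FrameCorrectedMinusMeanStep
import Literature.MathematicalPhysics.QuantumFieldTheory.Balaban1983to89.B5Eq118OneStroke
import Literature.MathematicalPhysics.QuantumFieldTheory.Balaban1983to89.B10StarCount
import HarnessLib

/-!
# Route `UnitScaleTilt`, crux K1 child «MinimiserStabilityRegPr» (stmt-QuantumFields-19200), skeleton v10, stub `stub_existenceMinimalOrbit` (EX), route (α) —
# **(R2t, FILE A2) THE FRAME-CORRECTED GAUGE OPERATOR MINUS THE NESTED COVARIANT MEAN, DOWN THE TOWER, AGAINST A BLOCK MAJORANT** (plan v2 row R2t; sequel of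
# `…FrameCorrectedMinusMeanStep`; LOCATE memo `pub/ym3-torus/ym3-torus-px6/LOCATE-R2t-px6g2.md`).

Cell `ym3-torus`, width seat `ym3-torus-px6` (gen 2).  THEOREMS ONLY (0 `def`, 0 `sorry`).  `--supports stmt-QuantumFields-19200 --as helper`, count-neutral.  YM₃ on T³ is a ladder
rung (R3), not the Clay problem; nothing here claims the stub, the crux, d = 4 or the mass gap.

THE POINT.  Induction down the comparison tower of `(U₀, U′)` with DISPLAYED per-level data (`‖τ_j − 1‖ ≤ δτ_j ≤ 1∕24`, `‖ν_j^{±1} − 1‖ ≤ δν_j`, contractive units — at T³ all `SU(2)`,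
supplied GEOMETRICALLY in `j` by ✓`Prop7SymAvgTwSym.norm_tstairU_sub_one_le_geom_of_regPr` ∕ ✓`norm_dbarCovIterU_rel_sub_one_le_geom_of_regPr`) and block majorants `R_j` of `N`
(`‖N‖ ≤ R₀`, super-averaging, children∕centre `≤ S·R_{j+1}`): **`‖𝓚_{A₁}N(z) − ns_k(z)‖ ≤ ε_k·R_k(z)`** with `ε_{j+1} ≥ ε_j + (1 + ε_j)(2(2δν_j + δτ_j) + 326·S·δτ_j)` — for the
response `V` produced by FR₁'s recursion (§4, ∃-form) and for EVERY derivative letter `V` (§5, `HasDerivAt.unique`).  The canonical majorant is the BLOCK RMS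
`R_j(z) = ((L^d)^{−j}Σ_{x∈B^j(z)}‖N x‖²)^{1∕2}` (§5: `blockRMS_zero`, `blockRMS_le_of_blockOf_eq` (F3, any `S² ≥ L^d`), `mean_blockRMS_le` (F2: AM ≤ QM + nesting)), for which the
pointwise bound sums to the coarse-`ℓ²`-against-fine-`ℓ²` form `Σ_z‖·‖² ≤ ε_k²·(L^d)^{−k}·Σ_x‖N x‖²` (`sum_normSq_le_of_blockRMS`).  The factor `S ~ L^{d∕2}` is the located price of
FR₁ §5 being a SUP statement on `Idx → 𝔸` (the centre child enters every `σ_i`); it multiplies the SUMMABLE `δτ_j` only, never the propagation of the error (a mean, contraction by F2).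

WHAT IS PROVED (sorry-free, no definition): §4 `norm_holT_dbar_sub_holT_bg_le`, ★★★`exists_frameResponse_norm_sub_avgSeq_le`; §5 ★★★`frameResponse_norm_sub_avgSeq_le`, `blockRMS_zero`,
`blockRMS_le_of_blockOf_eq`, `sum_idx_fst_real`, `card_idx_real`, `idxMean_eq_offsetMean`, `sq_offsetMean_le`, `mean_blockRMS_le`, `sum_normSq_le_of_blockRMS`.
HONEST SCOPE: the per-level tower data and the window on `ε` are displayed HYPOTHESES (the T³ member `…FrameCorrectedMinusMeanL2` discharges them from `RegPr` + the chart window);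
constants explicit and crude; nothing of print is asserted.

References: T. Bałaban, CMP 98 (1985) 17–51 [Balaban1985Averaging] ((58) p.27, (82) p.30, (89)–(92) p.31, (97) p.32); CMP 95 (1984) 17–40 [Balaban1984PropagatorsI] ((1.16)–(1.18)
p.20); CMP 99 (1985) 389–434 [Balaban1985BackgroundPropagators] ((3.11) p.392, (3.19) p.393, (3.21) p.394); CMP 109 (1987) 249–301 [Balaban1987RG1] ((0.3)–(0.4) pp.252–253).
-/

set_option autoImplicit false

noncomputable section

open scoped BigOperators Topology
open Filter NormedSpace Metric

namespace Summit.QuantumFields.YangMills.Theorems.Prop7FrameCorrectedMinusMean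

open Literature.MathematicalPhysics.QuantumFieldTheory.Balaban1983to89
open T4Continuum BlockAveraging ExpMeanLog MatrixLog
open B10Eq27TorusAxialLog (holT gaugeActT gaugeActT_apply transl)
open B7Prop1Explicit (expUnit val_expUnit disp)
open B7TransferAnalyticMean (meanCLM meanCLM_apply norm_meanCLM_apply_le)
open Summit.QuantumFields.YangMills.Theorems.Prop7SymAvgTwSym (tstairU tstairU_def vframeCovU coe_vframeCovU dbarCovIterU frameAccU frameAccU_succ frameAccU_zero
  frameAccU_self dbarCovIterU_self)
open Summit.QuantumFields.YangMills.Theorems.Prop7SymFrameGaugeResponseAt (hasDerivAt_frameAccU_succ_at norm_fderiv_eml_mul_sub_mean_mul_le)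
open Summit.QuantumFields.YangMills.Theorems.Prop7FrameLevelOnto (mul_meanCLM_mul transl_emb_disp_stairWord_eq_blockSite)
open Summit.QuantumFields.YangMills.Theorems.Prop8Chart (emlIterU)
open B15DeterminingSets (embIter)
open B5Eq118OneStroke (iterBlockOf iterBlock mem_iterBlock iterBlock_zero sum_iterBlock_succ card_iterBlock)
open B10StarCount (sum_block)

variable {𝔸 : Type*} [NormedRing 𝔸] [NormedAlgebra ℂ 𝔸] [CompleteSpace 𝔸]

/-! ## §4 The induction down the tower: `𝓚_{A₁}N − ns` is dominated by `ε_k` times the block majorant -/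

section Induction

variable {P : Params}

omit [NormedAlgebra ℂ 𝔸] [CompleteSpace 𝔸] in
/-- the moving stair holonomy against the background one: `τ_i = P_i·Q₀_i⁻¹` (✓`tstairU_def`) gives `‖P_i − Q₀_i‖ ≤ ‖τ − 1‖_∞` for contractive `Q₀_i`. [cite: Balaban1985Averaging, (58) p.27] -/
theorem norm_holT_dbar_sub_holT_bg_le {j : ℕ} (B E : GaugeField P j 𝔸ˣ) (y : Site P (j + 1)) (i : Idx P)
    (hQ : ‖((holT B (emb y) (stairWord i.2.1 (off i.1)) : 𝔸ˣ) : 𝔸)‖ ≤ 1) :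
    ‖((holT E (emb y) (stairWord i.2.1 (off i.1)) : 𝔸ˣ) : 𝔸) - holT B (emb y) (stairWord i.2.1 (off i.1))‖
      ≤ ‖(fun i' : Idx P => ((tstairU B E y i' : 𝔸ˣ) : 𝔸)) - 1‖ := by
  have hP : ((holT E (emb y) (stairWord i.2.1 (off i.1)) : 𝔸ˣ) : 𝔸) = ((tstairU B E y i : 𝔸ˣ) : 𝔸) * holT B (emb y) (stairWord i.2.1 (off i.1)) := by
    rw [tstairU_def, Units.val_mul, Units.inv_mul_cancel_right]
  have heq : ((holT E (emb y) (stairWord i.2.1 (off i.1)) : 𝔸ˣ) : 𝔸) - holT B (emb y) (stairWord i.2.1 (off i.1))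
      = (((tstairU B E y i : 𝔸ˣ) : 𝔸) - 1) * holT B (emb y) (stairWord i.2.1 (off i.1)) := by rw [sub_mul, one_mul, ← hP]
  rw [heq]
  have hi : ‖((tstairU B E y i : 𝔸ˣ) : 𝔸) - 1‖ ≤ ‖(fun i' : Idx P => ((tstairU B E y i' : 𝔸ˣ) : 𝔸)) - 1‖ := by
    have := norm_le_pi_norm ((fun i' : Idx P => ((tstairU B E y i' : 𝔸ˣ) : 𝔸)) - 1) i
    simpa only [Pi.sub_apply, Pi.one_apply] using this
  calc _ ≤ ‖((tstairU B E y i : 𝔸ˣ) : 𝔸) - 1‖ * ‖((holT B (emb y) (stairWord i.2.1 (off i.1)) : 𝔸ˣ) : 𝔸)‖ := norm_mul_le _ _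
    _ ≤ ‖(fun i' : Idx P => ((tstairU B E y i' : 𝔸ˣ) : 𝔸)) - 1‖ * 1 := by gcongr
    _ = _ := mul_one _

/-- ★★★ **`𝓚_{A₁}N − 𝓚₀N` DOWN THE TOWER, AGAINST A BLOCK MAJORANT** (R2t, generic form).  Let `U₀, U′` be level-`0` unit fields, `g_t` a gauge family through `1` with site derivative `N`,
`ns` an averaging sequence of `N` against the background tower (`h0`, `hsucc`: the letters of ✓`QTwS_gaugeDir_of_avgSeq` ∕ ✓`hasDerivAt_frameAccU_of_avgSeq`, i.e. `𝓚₀N = ns`), and suppose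
at every level `j < k₀` the DISPLAYED tower data: stair transporters `‖τ_j(y) − 1‖ ≤ δτ_j ≤ 1∕24` (`j < k₀`), accumulated frames `‖ν_j(x)^{±1} − 1‖ ≤ δν_j`, and CONTRACTIVE units (`‖u^{±1}‖ ≤ 1` for the
frames, the one-level frames, the stair holonomies of the moving tower `D̄_j` and of the background tower `Ū₀⁽ʲ⁾`; at T³ all are `SU(2)`).  Let `R_j(z) ≥ 0` be block majorants of `N`
(`‖N x‖ ≤ R₀(x)`; super-averaging `mean_i R_j(x_{y,i}) ≤ R_{j+1}(y)`; children and centre `R_j(x_{y,i}), R_j(ŷ) ≤ S·R_{j+1}(y)`) and `ε_j ≥ 0` with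
`ε_j + (1 + ε_j)(2(2δν_j + δτ_j) + 326·S·δτ_j) ≤ ε_{j+1}`.  THEN for every `k ≤ k₀` there is a response `V` of the accumulated frames along `U′^{g_t}`
(`d∕dt|₀ frameAccU k U₀ (U′^{g_t}) x = V x`) with **`‖(N(x̂⁽ᵏ⁾z) − V(z)·ν_k(z)⁻¹) − ns_k(z)‖ ≤ ε_k·R_k(z)`** at every level-`k` site.  Induction: `V_{k+1}` is FR₁ §4's successor
(✓`hasDerivAt_frameAccU_succ_at`), and the estimate is §2 at `A := (1 + ε_k)·S·R_{k+1}(y)` with §3 (`‖ns_k‖ ≤ R_k`) for the sizes. [cite: Balaban1985Averaging, (97) p.32, (82) p.30, (89)-(92) p.31; Balaban1985BackgroundPropagators, (3.19) p.393, (3.21) p.394; Balaban1987RG1, (0.3)-(0.4) pp.252-253] -/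
theorem exists_frameResponse_norm_sub_avgSeq_le (U₀ U' : GaugeField P 0 𝔸ˣ) {g : ℝ → Site P 0 → 𝔸ˣ} {N : Site P 0 → 𝔸} (hg0 : g 0 = fun _ => 1)
    (hgd : ∀ x, HasDerivAt (fun t : ℝ => ((g t x : 𝔸ˣ) : 𝔸)) (N x) 0) (ns : (j : ℕ) → Site P j → 𝔸) (h0 : ns 0 = N)
    (hsucc : ∀ (j : ℕ) (y : Site P (j + 1)), ns (j + 1) y = ns j (emb y) - meanCLM (Idx P) 𝔸 fun i : Idx P =>
        ns j (emb y) - ((holT (emlIterU j U₀) (emb y) (stairWord i.2.1 (off i.1)) : 𝔸ˣ) : 𝔸) * ns j (transl (emb y) (disp (stairWord i.2.1 (off i.1)))) *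
          (((holT (emlIterU j U₀) (emb y) (stairWord i.2.1 (off i.1)))⁻¹ : 𝔸ˣ) : 𝔸))
    (k₀ : ℕ) (δτ δν ε : ℕ → ℝ) {S : ℝ} (hS : 0 ≤ S) (hδτ : ∀ j, j < k₀ → δτ j ≤ 1 / 24)
    (hτ : ∀ (j : ℕ) (y : Site P (j + 1)), j < k₀ → ‖(fun i : Idx P => ((tstairU (emlIterU j U₀) (dbarCovIterU j U₀ U') y i : 𝔸ˣ) : 𝔸)) - 1‖ ≤ δτ j)
    (hν : ∀ (j : ℕ) (x : Site P j), j < k₀ → ‖((frameAccU j U₀ U' x : 𝔸ˣ) : 𝔸)‖ ≤ 1)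
    (hν' : ∀ (j : ℕ) (x : Site P j), j < k₀ → ‖(((frameAccU j U₀ U' x)⁻¹ : 𝔸ˣ) : 𝔸)‖ ≤ 1)
    (hν1 : ∀ (j : ℕ) (x : Site P j), j < k₀ → ‖((frameAccU j U₀ U' x : 𝔸ˣ) : 𝔸) - 1‖ ≤ δν j)
    (hν1' : ∀ (j : ℕ) (x : Site P j), j < k₀ → ‖(((frameAccU j U₀ U' x)⁻¹ : 𝔸ˣ) : 𝔸) - 1‖ ≤ δν j)
    (hw' : ∀ (j : ℕ) (y : Site P (j + 1)), j < k₀ → ‖(((vframeCovU (emlIterU j U₀) (dbarCovIterU j U₀ U') y)⁻¹ : 𝔸ˣ) : 𝔸)‖ ≤ 1)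
    (hP : ∀ (j : ℕ) (y : Site P (j + 1)) (i : Idx P), j < k₀ → ‖((holT (dbarCovIterU j U₀ U') (emb y) (stairWord i.2.1 (off i.1)) : 𝔸ˣ) : 𝔸)‖ ≤ 1)
    (hP' : ∀ (j : ℕ) (y : Site P (j + 1)) (i : Idx P), j < k₀ → ‖(((holT (dbarCovIterU j U₀ U') (emb y) (stairWord i.2.1 (off i.1)))⁻¹ : 𝔸ˣ) : 𝔸)‖ ≤ 1)
    (hQ : ∀ (j : ℕ) (y : Site P (j + 1)) (i : Idx P), j < k₀ → ‖((holT (emlIterU j U₀) (emb y) (stairWord i.2.1 (off i.1)) : 𝔸ˣ) : 𝔸)‖ ≤ 1)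
    (hQ' : ∀ (j : ℕ) (y : Site P (j + 1)) (i : Idx P), j < k₀ → ‖(((holT (emlIterU j U₀) (emb y) (stairWord i.2.1 (off i.1)))⁻¹ : 𝔸ˣ) : 𝔸)‖ ≤ 1)
    (R : (j : ℕ) → Site P j → ℝ) (hRnn : ∀ j z, 0 ≤ R j z) (hR0 : ∀ x, ‖N x‖ ≤ R 0 x)
    (hRmean : ∀ (j : ℕ) (y : Site P (j + 1)), j < k₀ → (Fintype.card (Idx P) : ℝ)⁻¹ * ∑ i : Idx P, R j (Site.blockSite y i.1) ≤ R (j + 1) y)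
    (hRsup : ∀ (j : ℕ) (y : Site P (j + 1)) (i : Idx P), j < k₀ → R j (Site.blockSite y i.1) ≤ S * R (j + 1) y)
    (hRctr : ∀ (j : ℕ) (y : Site P (j + 1)), j < k₀ → R j (emb y) ≤ S * R (j + 1) y)
    (hε : ∀ j, 0 ≤ ε j) (hεsucc : ∀ j, j < k₀ → ε j + (1 + ε j) * (2 * (2 * δν j + δτ j) + 326 * S * δτ j) ≤ ε (j + 1)) :
    ∀ (k : ℕ), k ≤ k₀ → ∃ V : Site P k → 𝔸,
      (∀ x : Site P k, HasDerivAt (fun t : ℝ => ((frameAccU k U₀ (gaugeActT (g t) U') x : 𝔸ˣ) : 𝔸)) (V x) 0) ∧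
      ∀ z : Site P k, ‖(N (embIter k z) - V z * (((frameAccU k U₀ U' z)⁻¹ : 𝔸ˣ) : 𝔸)) - ns k z‖ ≤ ε k * R k z
  | 0, _ => by
    refine ⟨fun _ => 0, fun x => ?_, fun z => ?_⟩
    · have h1 : (fun t : ℝ => ((frameAccU 0 U₀ (gaugeActT (g t) U') x : 𝔸ˣ) : 𝔸)) = fun _ => 1 := by
        funext t; rw [frameAccU_zero, Units.val_one]
      rw [h1]; exact hasDerivAt_const 0 1
    · have h1 : N (embIter 0 z) = N z := rfl
      rw [h1, h0, zero_mul, sub_zero, sub_self, norm_zero]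
      exact mul_nonneg (hε 0) (hRnn 0 z)
  | k + 1, hk => by
    have hjk : k < k₀ := by omega
    obtain ⟨V, hV, hbd⟩ := exists_frameResponse_norm_sub_avgSeq_le U₀ U' hg0 hgd ns h0 hsucc k₀ δτ δν ε hS hδτ hτ hν hν' hν1 hν1' hw' hP hP' hQ hQ' R hRnn hR0
      hRmean hRsup hRctr hε hεsucc k (by omega)
    refine ⟨fun y => V (emb y) * ((vframeCovU (emlIterU k U₀) (dbarCovIterU k U₀ U') y : 𝔸ˣ) : 𝔸) +
        ((frameAccU k U₀ U' (emb y) : 𝔸ˣ) : 𝔸) *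
          fderiv ℂ (eml : (Idx P → 𝔸) → 𝔸) (fun i : Idx P => ((tstairU (emlIterU k U₀) (dbarCovIterU k U₀ U') y i : 𝔸ˣ) : 𝔸))
            (fun i : Idx P =>
              ((((frameAccU k U₀ U' (emb y))⁻¹ : 𝔸ˣ) : 𝔸) * (N (embIter k (emb y)) - V (emb y) * (((frameAccU k U₀ U' (emb y))⁻¹ : 𝔸ˣ) : 𝔸)) *
                    ((frameAccU k U₀ U' (emb y) : 𝔸ˣ) : 𝔸) -
                  ((holT (dbarCovIterU k U₀ U') (emb y) (stairWord i.2.1 (off i.1)) : 𝔸ˣ) : 𝔸) *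
                      ((((frameAccU k U₀ U' (transl (emb y) (disp (stairWord i.2.1 (off i.1)))))⁻¹ : 𝔸ˣ) : 𝔸) *
                          (N (embIter k (transl (emb y) (disp (stairWord i.2.1 (off i.1))))) -
                            V (transl (emb y) (disp (stairWord i.2.1 (off i.1)))) *
                              (((frameAccU k U₀ U' (transl (emb y) (disp (stairWord i.2.1 (off i.1)))))⁻¹ : 𝔸ˣ) : 𝔸)) *
                        ((frameAccU k U₀ U' (transl (emb y) (disp (stairWord i.2.1 (off i.1)))) : 𝔸ˣ) : 𝔸)) *
                    (((holT (dbarCovIterU k U₀ U') (emb y) (stairWord i.2.1 (off i.1)))⁻¹ : 𝔸ˣ) : 𝔸)) *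
                ((tstairU (emlIterU k U₀) (dbarCovIterU k U₀ U') y i : 𝔸ˣ) : 𝔸)), fun y => ?_, fun y => ?_⟩
    · exact hasDerivAt_frameAccU_succ_at U₀ U' hg0 hgd k hV y ((hτ k y hjk).trans_lt ((hδτ k hjk).trans_lt (by norm_num)))
    · -- the letters at the coarse site `y`
      have hτk := hτ k y hjk
      have hδτ0 : 0 ≤ δτ k := (norm_nonneg _).trans hτk
      have hδν0 : 0 ≤ δν k := (norm_nonneg _).trans (hν1 k (emb y) hjk)
      have hεk := hε k
      have hR' := hRnn (k + 1) y
      -- sizes of the level-`k` frame-corrected values: `‖ρ_k(z)‖ ≤ (1 + ε_k)·R_k(z)`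
      have hρ : ∀ z : Site P k, ‖N (embIter k z) - V z * (((frameAccU k U₀ U' z)⁻¹ : 𝔸ˣ) : 𝔸)‖ ≤ (1 + ε k) * R k z := by
        intro z
        have hns := norm_avgSeq_le_majorant U₀ k₀ ns h0 hsucc hQ hQ' R hR0 hRmean k hjk.le z
        calc ‖N (embIter k z) - V z * (((frameAccU k U₀ U' z)⁻¹ : 𝔸ˣ) : 𝔸)‖
            = ‖(N (embIter k z) - V z * (((frameAccU k U₀ U' z)⁻¹ : 𝔸ˣ) : 𝔸) - ns k z) + ns k z‖ := by rw [sub_add_cancel]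
          _ ≤ ‖N (embIter k z) - V z * (((frameAccU k U₀ U' z)⁻¹ : 𝔸ˣ) : 𝔸) - ns k z‖ + ‖ns k z‖ := norm_add_le _ _
          _ ≤ ε k * R k z + R k z := add_le_add (hbd z) hns
          _ = (1 + ε k) * R k z := by ring
      have hA : ‖N (embIter k (emb y)) - V (emb y) * (((frameAccU k U₀ U' (emb y))⁻¹ : 𝔸ˣ) : 𝔸)‖ ≤ (1 + ε k) * (S * R (k + 1) y) :=
        (hρ (emb y)).trans (mul_le_mul_of_nonneg_left (hRctr k y hjk) (by linarith))
      have hB : ∀ i : Idx P, ‖N (embIter k (transl (emb y) (disp (stairWord i.2.1 (off i.1))))) - V (transl (emb y) (disp (stairWord i.2.1 (off i.1)))) *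
          (((frameAccU k U₀ U' (transl (emb y) (disp (stairWord i.2.1 (off i.1)))))⁻¹ : 𝔸ˣ) : 𝔸)‖ ≤ (1 + ε k) * (S * R (k + 1) y) := by
        intro i
        refine (hρ _).trans (mul_le_mul_of_nonneg_left ?_ (by linarith))
        rw [transl_emb_disp_stairWord_eq_blockSite]; exact hRsup k y i hjk
      -- §2 at this site
      have hcore : ‖(N (embIter k (emb y)) - V (emb y) * (((frameAccU k U₀ U' (emb y))⁻¹ : 𝔸ˣ) : 𝔸) -
            ((frameAccU k U₀ U' (emb y) : 𝔸ˣ) : 𝔸) *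
              fderiv ℂ (eml : (Idx P → 𝔸) → 𝔸) (fun i : Idx P => ((tstairU (emlIterU k U₀) (dbarCovIterU k U₀ U') y i : 𝔸ˣ) : 𝔸))
                (fun i : Idx P =>
                  ((((frameAccU k U₀ U' (emb y))⁻¹ : 𝔸ˣ) : 𝔸) * (N (embIter k (emb y)) - V (emb y) * (((frameAccU k U₀ U' (emb y))⁻¹ : 𝔸ˣ) : 𝔸)) *
                        ((frameAccU k U₀ U' (emb y) : 𝔸ˣ) : 𝔸) -
                      ((holT (dbarCovIterU k U₀ U') (emb y) (stairWord i.2.1 (off i.1)) : 𝔸ˣ) : 𝔸) *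
                          ((((frameAccU k U₀ U' (transl (emb y) (disp (stairWord i.2.1 (off i.1)))))⁻¹ : 𝔸ˣ) : 𝔸) *
                              (N (embIter k (transl (emb y) (disp (stairWord i.2.1 (off i.1))))) -
                                V (transl (emb y) (disp (stairWord i.2.1 (off i.1)))) *
                                  (((frameAccU k U₀ U' (transl (emb y) (disp (stairWord i.2.1 (off i.1)))))⁻¹ : 𝔸ˣ) : 𝔸)) *
                            ((frameAccU k U₀ U' (transl (emb y) (disp (stairWord i.2.1 (off i.1)))) : 𝔸ˣ) : 𝔸)) *
                        (((holT (dbarCovIterU k U₀ U') (emb y) (stairWord i.2.1 (off i.1)))⁻¹ : 𝔸ˣ) : 𝔸)) *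
                    ((tstairU (emlIterU k U₀) (dbarCovIterU k U₀ U') y i : 𝔸ˣ) : 𝔸)) *
              (((vframeCovU (emlIterU k U₀) (dbarCovIterU k U₀ U') y)⁻¹ : 𝔸ˣ) : 𝔸) * (((frameAccU k U₀ U' (emb y))⁻¹ : 𝔸ˣ) : 𝔸))
          - meanCLM (Idx P) 𝔸 (fun i : Idx P => ((holT (emlIterU k U₀) (emb y) (stairWord i.2.1 (off i.1)) : 𝔸ˣ) : 𝔸) *
              ns k (transl (emb y) (disp (stairWord i.2.1 (off i.1)))) * (((holT (emlIterU k U₀) (emb y) (stairWord i.2.1 (off i.1)))⁻¹ : 𝔸ˣ) : 𝔸))‖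
          ≤ (Fintype.card (Idx P) : ℝ)⁻¹ * ∑ i : Idx P, ‖(N (embIter k (transl (emb y) (disp (stairWord i.2.1 (off i.1))))) -
                V (transl (emb y) (disp (stairWord i.2.1 (off i.1)))) * (((frameAccU k U₀ U' (transl (emb y) (disp (stairWord i.2.1 (off i.1)))))⁻¹ : 𝔸ˣ) : 𝔸)) -
                ns k (transl (emb y) (disp (stairWord i.2.1 (off i.1))))‖
            + 2 * (2 * δν k + δτ k) * ((Fintype.card (Idx P) : ℝ)⁻¹ * ∑ i : Idx P, ‖N (embIter k (transl (emb y) (disp (stairWord i.2.1 (off i.1))))) -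
                V (transl (emb y) (disp (stairWord i.2.1 (off i.1)))) * (((frameAccU k U₀ U' (transl (emb y) (disp (stairWord i.2.1 (off i.1)))))⁻¹ : 𝔸ˣ) : 𝔸)‖)
            + 326 * ((1 + ε k) * (S * R (k + 1) y)) * δτ k :=
        norm_levelStep_sub_mean_le (fun i : Idx P => ((tstairU (emlIterU k U₀) (dbarCovIterU k U₀ U') y i : 𝔸ˣ) : 𝔸)) (hδτ k hjk) hτk
          (frameAccU k U₀ U' (emb y)) (vframeCovU (emlIterU k U₀) (dbarCovIterU k U₀ U') y)
          (fun i : Idx P => frameAccU k U₀ U' (transl (emb y) (disp (stairWord i.2.1 (off i.1)))))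
          (fun i : Idx P => holT (dbarCovIterU k U₀ U') (emb y) (stairWord i.2.1 (off i.1)))
          (fun i : Idx P => holT (emlIterU k U₀) (emb y) (stairWord i.2.1 (off i.1))) (coe_vframeCovU _ _ _)
          (hν k (emb y) hjk) (hν' k (emb y) hjk) (hw' k y hjk) (fun i => hν k _ hjk) (fun i => hν' k _ hjk) (fun i => hP k y i hjk) (fun i => hP' k y i hjk)
          (fun i => hQ k y i hjk) (fun i => hQ' k y i hjk) (hν1 k (emb y) hjk) (fun i => hν1' k _ hjk)
          (fun i => norm_holT_dbar_sub_holT_bg_le (emlIterU k U₀) (dbarCovIterU k U₀ U') y i (hQ k y i hjk) |>.trans hτk)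
          _ _ (fun i : Idx P => ns k (transl (emb y) (disp (stairWord i.2.1 (off i.1))))) hA hB
      -- the raw successor value IS §2's left side
      have hρsucc : N (embIter (k + 1) y) -
            (V (emb y) * ((vframeCovU (emlIterU k U₀) (dbarCovIterU k U₀ U') y : 𝔸ˣ) : 𝔸) +
              ((frameAccU k U₀ U' (emb y) : 𝔸ˣ) : 𝔸) *
                fderiv ℂ (eml : (Idx P → 𝔸) → 𝔸) (fun i : Idx P => ((tstairU (emlIterU k U₀) (dbarCovIterU k U₀ U') y i : 𝔸ˣ) : 𝔸))
                  (fun i : Idx P =>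
                    ((((frameAccU k U₀ U' (emb y))⁻¹ : 𝔸ˣ) : 𝔸) * (N (embIter k (emb y)) - V (emb y) * (((frameAccU k U₀ U' (emb y))⁻¹ : 𝔸ˣ) : 𝔸)) *
                          ((frameAccU k U₀ U' (emb y) : 𝔸ˣ) : 𝔸) -
                        ((holT (dbarCovIterU k U₀ U') (emb y) (stairWord i.2.1 (off i.1)) : 𝔸ˣ) : 𝔸) *
                            ((((frameAccU k U₀ U' (transl (emb y) (disp (stairWord i.2.1 (off i.1)))))⁻¹ : 𝔸ˣ) : 𝔸) *
                                (N (embIter k (transl (emb y) (disp (stairWord i.2.1 (off i.1))))) -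
                                  V (transl (emb y) (disp (stairWord i.2.1 (off i.1)))) *
                                    (((frameAccU k U₀ U' (transl (emb y) (disp (stairWord i.2.1 (off i.1)))))⁻¹ : 𝔸ˣ) : 𝔸)) *
                              ((frameAccU k U₀ U' (transl (emb y) (disp (stairWord i.2.1 (off i.1)))) : 𝔸ˣ) : 𝔸)) *
                          (((holT (dbarCovIterU k U₀ U') (emb y) (stairWord i.2.1 (off i.1)))⁻¹ : 𝔸ˣ) : 𝔸)) *
                      ((tstairU (emlIterU k U₀) (dbarCovIterU k U₀ U') y i : 𝔸ˣ) : 𝔸))) *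
              (((frameAccU (k + 1) U₀ U' y)⁻¹ : 𝔸ˣ) : 𝔸)
          = N (embIter k (emb y)) - V (emb y) * (((frameAccU k U₀ U' (emb y))⁻¹ : 𝔸ˣ) : 𝔸) -
            ((frameAccU k U₀ U' (emb y) : 𝔸ˣ) : 𝔸) *
              fderiv ℂ (eml : (Idx P → 𝔸) → 𝔸) (fun i : Idx P => ((tstairU (emlIterU k U₀) (dbarCovIterU k U₀ U') y i : 𝔸ˣ) : 𝔸))
                (fun i : Idx P =>
                  ((((frameAccU k U₀ U' (emb y))⁻¹ : 𝔸ˣ) : 𝔸) * (N (embIter k (emb y)) - V (emb y) * (((frameAccU k U₀ U' (emb y))⁻¹ : 𝔸ˣ) : 𝔸)) *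
                        ((frameAccU k U₀ U' (emb y) : 𝔸ˣ) : 𝔸) -
                      ((holT (dbarCovIterU k U₀ U') (emb y) (stairWord i.2.1 (off i.1)) : 𝔸ˣ) : 𝔸) *
                          ((((frameAccU k U₀ U' (transl (emb y) (disp (stairWord i.2.1 (off i.1)))))⁻¹ : 𝔸ˣ) : 𝔸) *
                              (N (embIter k (transl (emb y) (disp (stairWord i.2.1 (off i.1))))) -
                                V (transl (emb y) (disp (stairWord i.2.1 (off i.1)))) *
                                  (((frameAccU k U₀ U' (transl (emb y) (disp (stairWord i.2.1 (off i.1)))))⁻¹ : 𝔸ˣ) : 𝔸)) *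
                            ((frameAccU k U₀ U' (transl (emb y) (disp (stairWord i.2.1 (off i.1)))) : 𝔸ˣ) : 𝔸)) *
                        (((holT (dbarCovIterU k U₀ U') (emb y) (stairWord i.2.1 (off i.1)))⁻¹ : 𝔸ˣ) : 𝔸)) *
                    ((tstairU (emlIterU k U₀) (dbarCovIterU k U₀ U') y i : 𝔸ˣ) : 𝔸)) *
              (((vframeCovU (emlIterU k U₀) (dbarCovIterU k U₀ U') y)⁻¹ : 𝔸ˣ) : 𝔸) * (((frameAccU k U₀ U' (emb y))⁻¹ : 𝔸ˣ) : 𝔸) := by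
        rw [show embIter (k + 1) y = embIter k (emb y) from rfl, frameAccU_succ, mul_inv_rev, Units.val_mul]
        simp only [add_mul, mul_assoc, Units.mul_inv_cancel_left]
        abel
      beta_reduce
      rw [hρsucc, avgSeq_succ_eq_mean U₀ ns hsucc k y]
      refine hcore.trans ?_
      -- the three sizes
      have hm1 : (Fintype.card (Idx P) : ℝ)⁻¹ * ∑ i : Idx P, ‖(N (embIter k (transl (emb y) (disp (stairWord i.2.1 (off i.1))))) -
            V (transl (emb y) (disp (stairWord i.2.1 (off i.1)))) * (((frameAccU k U₀ U' (transl (emb y) (disp (stairWord i.2.1 (off i.1)))))⁻¹ : 𝔸ˣ) : 𝔸)) -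
            ns k (transl (emb y) (disp (stairWord i.2.1 (off i.1))))‖ ≤ ε k * R (k + 1) y := by
        calc _ ≤ (Fintype.card (Idx P) : ℝ)⁻¹ * ∑ i : Idx P, ε k * R k (Site.blockSite y i.1) := by
              refine mul_le_mul_of_nonneg_left (Finset.sum_le_sum fun i _ => ?_) (by positivity)
              rw [transl_emb_disp_stairWord_eq_blockSite]; exact hbd _
          _ = ε k * ((Fintype.card (Idx P) : ℝ)⁻¹ * ∑ i : Idx P, R k (Site.blockSite y i.1)) := by rw [← Finset.mul_sum]; ring
          _ ≤ ε k * R (k + 1) y := mul_le_mul_of_nonneg_left (hRmean k y hjk) hεk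
      have hm2 : (Fintype.card (Idx P) : ℝ)⁻¹ * ∑ i : Idx P, ‖N (embIter k (transl (emb y) (disp (stairWord i.2.1 (off i.1))))) -
            V (transl (emb y) (disp (stairWord i.2.1 (off i.1)))) * (((frameAccU k U₀ U' (transl (emb y) (disp (stairWord i.2.1 (off i.1)))))⁻¹ : 𝔸ˣ) : 𝔸)‖
          ≤ (1 + ε k) * R (k + 1) y := by
        calc _ ≤ (Fintype.card (Idx P) : ℝ)⁻¹ * ∑ i : Idx P, (1 + ε k) * R k (Site.blockSite y i.1) := by
              refine mul_le_mul_of_nonneg_left (Finset.sum_le_sum fun i _ => ?_) (by positivity)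
              rw [transl_emb_disp_stairWord_eq_blockSite]; exact hρ _
          _ = (1 + ε k) * ((Fintype.card (Idx P) : ℝ)⁻¹ * ∑ i : Idx P, R k (Site.blockSite y i.1)) := by rw [← Finset.mul_sum]; ring
          _ ≤ (1 + ε k) * R (k + 1) y := mul_le_mul_of_nonneg_left (hRmean k y hjk) (by linarith)
      have h2δ : 0 ≤ 2 * (2 * δν k + δτ k) := by positivity
      calc _ ≤ ε k * R (k + 1) y + 2 * (2 * δν k + δτ k) * ((1 + ε k) * R (k + 1) y) + 326 * ((1 + ε k) * (S * R (k + 1) y)) * δτ k := by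
            gcongr
        _ = (ε k + (1 + ε k) * (2 * (2 * δν k + δτ k) + 326 * S * δτ k)) * R (k + 1) y := by ring
        _ ≤ ε (k + 1) * R (k + 1) y := mul_le_mul_of_nonneg_right (hεsucc k hjk) hR'

end Induction

/-! ## §5 Every derivative letter; the block RMS majorant; the squared-sum form -/

section Packaging

variable {P : Params}

/-- ★★★ **THE SAME BOUND FOR EVERY DERIVATIVE LETTER `V`** (the consumer's `V`, e.g. the one of ✓`exists_frameCorrected_eq` or of the GLUE ✓`fderiv_frameTwS_apply_eq_of_chartCurve`): derivatives are unique.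
[cite: Balaban1985Averaging, (97) p.32; Balaban1985BackgroundPropagators, (3.19) p.393] -/
theorem frameResponse_norm_sub_avgSeq_le (U₀ U' : GaugeField P 0 𝔸ˣ) {g : ℝ → Site P 0 → 𝔸ˣ} {N : Site P 0 → 𝔸} (hg0 : g 0 = fun _ => 1)
    (hgd : ∀ x, HasDerivAt (fun t : ℝ => ((g t x : 𝔸ˣ) : 𝔸)) (N x) 0) (ns : (j : ℕ) → Site P j → 𝔸) (h0 : ns 0 = N)
    (hsucc : ∀ (j : ℕ) (y : Site P (j + 1)), ns (j + 1) y = ns j (emb y) - meanCLM (Idx P) 𝔸 fun i : Idx P =>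
        ns j (emb y) - ((holT (emlIterU j U₀) (emb y) (stairWord i.2.1 (off i.1)) : 𝔸ˣ) : 𝔸) * ns j (transl (emb y) (disp (stairWord i.2.1 (off i.1)))) *
          (((holT (emlIterU j U₀) (emb y) (stairWord i.2.1 (off i.1)))⁻¹ : 𝔸ˣ) : 𝔸))
    (k₀ : ℕ) (δτ δν ε : ℕ → ℝ) {S : ℝ} (hS : 0 ≤ S) (hδτ : ∀ j, j < k₀ → δτ j ≤ 1 / 24)
    (hτ : ∀ (j : ℕ) (y : Site P (j + 1)), j < k₀ → ‖(fun i : Idx P => ((tstairU (emlIterU j U₀) (dbarCovIterU j U₀ U') y i : 𝔸ˣ) : 𝔸)) - 1‖ ≤ δτ j)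
    (hν : ∀ (j : ℕ) (x : Site P j), j < k₀ → ‖((frameAccU j U₀ U' x : 𝔸ˣ) : 𝔸)‖ ≤ 1)
    (hν' : ∀ (j : ℕ) (x : Site P j), j < k₀ → ‖(((frameAccU j U₀ U' x)⁻¹ : 𝔸ˣ) : 𝔸)‖ ≤ 1)
    (hν1 : ∀ (j : ℕ) (x : Site P j), j < k₀ → ‖((frameAccU j U₀ U' x : 𝔸ˣ) : 𝔸) - 1‖ ≤ δν j)
    (hν1' : ∀ (j : ℕ) (x : Site P j), j < k₀ → ‖(((frameAccU j U₀ U' x)⁻¹ : 𝔸ˣ) : 𝔸) - 1‖ ≤ δν j)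
    (hw' : ∀ (j : ℕ) (y : Site P (j + 1)), j < k₀ → ‖(((vframeCovU (emlIterU j U₀) (dbarCovIterU j U₀ U') y)⁻¹ : 𝔸ˣ) : 𝔸)‖ ≤ 1)
    (hP : ∀ (j : ℕ) (y : Site P (j + 1)) (i : Idx P), j < k₀ → ‖((holT (dbarCovIterU j U₀ U') (emb y) (stairWord i.2.1 (off i.1)) : 𝔸ˣ) : 𝔸)‖ ≤ 1)
    (hP' : ∀ (j : ℕ) (y : Site P (j + 1)) (i : Idx P), j < k₀ → ‖(((holT (dbarCovIterU j U₀ U') (emb y) (stairWord i.2.1 (off i.1)))⁻¹ : 𝔸ˣ) : 𝔸)‖ ≤ 1)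
    (hQ : ∀ (j : ℕ) (y : Site P (j + 1)) (i : Idx P), j < k₀ → ‖((holT (emlIterU j U₀) (emb y) (stairWord i.2.1 (off i.1)) : 𝔸ˣ) : 𝔸)‖ ≤ 1)
    (hQ' : ∀ (j : ℕ) (y : Site P (j + 1)) (i : Idx P), j < k₀ → ‖(((holT (emlIterU j U₀) (emb y) (stairWord i.2.1 (off i.1)))⁻¹ : 𝔸ˣ) : 𝔸)‖ ≤ 1)
    (R : (j : ℕ) → Site P j → ℝ) (hRnn : ∀ j z, 0 ≤ R j z) (hR0 : ∀ x, ‖N x‖ ≤ R 0 x)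
    (hRmean : ∀ (j : ℕ) (y : Site P (j + 1)), j < k₀ → (Fintype.card (Idx P) : ℝ)⁻¹ * ∑ i : Idx P, R j (Site.blockSite y i.1) ≤ R (j + 1) y)
    (hRsup : ∀ (j : ℕ) (y : Site P (j + 1)) (i : Idx P), j < k₀ → R j (Site.blockSite y i.1) ≤ S * R (j + 1) y)
    (hRctr : ∀ (j : ℕ) (y : Site P (j + 1)), j < k₀ → R j (emb y) ≤ S * R (j + 1) y)
    (hε : ∀ j, 0 ≤ ε j) (hεsucc : ∀ j, j < k₀ → ε j + (1 + ε j) * (2 * (2 * δν j + δτ j) + 326 * S * δτ j) ≤ ε (j + 1))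
    {k : ℕ} (hk : k ≤ k₀) {V : Site P k → 𝔸} (hV : ∀ x : Site P k, HasDerivAt (fun t : ℝ => ((frameAccU k U₀ (gaugeActT (g t) U') x : 𝔸ˣ) : 𝔸)) (V x) 0)
    (z : Site P k) : ‖(N (embIter k z) - V z * (((frameAccU k U₀ U' z)⁻¹ : 𝔸ˣ) : 𝔸)) - ns k z‖ ≤ ε k * R k z := by
  obtain ⟨V', hV', hb⟩ := exists_frameResponse_norm_sub_avgSeq_le U₀ U' hg0 hgd ns h0 hsucc k₀ δτ δν ε hS hδτ hτ hν hν' hν1 hν1' hw' hP hP' hQ hQ' R hRnn hR0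
    hRmean hRsup hRctr hε hεsucc k hk
  rw [(hV z).unique (hV' z)]
  exact hb z

omit [NormedAlgebra ℂ 𝔸] [CompleteSpace 𝔸] in
/-- the block RMS at level `0` is `‖N x‖`. [cite: Balaban1984PropagatorsI, (1.18) p.20] -/
theorem blockRMS_zero (N : Site P 0 → 𝔸) (x : Site P 0) :
    Real.sqrt ((((P.L : ℝ) ^ P.d) ^ 0)⁻¹ * ∑ x' ∈ iterBlock 0 x, ‖N x'‖ ^ 2) = ‖N x‖ := by
  rw [pow_zero, inv_one, one_mul, iterBlock_zero, Finset.sum_singleton, Real.sqrt_sq (norm_nonneg _)]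

omit [NormedAlgebra ℂ 𝔸] [CompleteSpace 𝔸] in
/-- (F3) a sub-block's RMS is at most `S` times the block's RMS whenever `L^d ≤ S²` (sub-sum of a sum of squares; the blocks nest, ✓`sum_iterBlock_succ`).
[cite: Balaban1984PropagatorsI, (1.16)-(1.18) p.20] -/
theorem blockRMS_le_of_blockOf_eq {j : ℕ} (N : Site P 0 → 𝔸) {S : ℝ} (hS : 0 ≤ S) (hLS : (P.L : ℝ) ^ P.d ≤ S ^ 2)
    (y : Site P (j + 1)) (z : Site P j) (hz : blockOf z = y) :
    Real.sqrt ((((P.L : ℝ) ^ P.d) ^ j)⁻¹ * ∑ x ∈ iterBlock j z, ‖N x‖ ^ 2)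
      ≤ S * Real.sqrt ((((P.L : ℝ) ^ P.d) ^ (j + 1))⁻¹ * ∑ x ∈ iterBlock (j + 1) y, ‖N x‖ ^ 2) := by
  have hL : (0 : ℝ) < (P.L : ℝ) ^ P.d := by have := P.L_pos; positivity
  have hzb : z ∈ block y := by simp [block, hz]
  have hsub : ∑ x ∈ iterBlock j z, ‖N x‖ ^ 2 ≤ ∑ x ∈ iterBlock (j + 1) y, ‖N x‖ ^ 2 := by
    rw [sum_iterBlock_succ]
    exact Finset.single_le_sum (f := fun z' => ∑ x ∈ iterBlock j z', ‖N x‖ ^ 2) (fun z' _ => Finset.sum_nonneg fun x _ => sq_nonneg _) hzb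
  rw [← Real.sqrt_sq hS, ← Real.sqrt_mul (sq_nonneg S)]
  apply Real.sqrt_le_sqrt
  have hscal : (((P.L : ℝ) ^ P.d) ^ j)⁻¹ = (P.L : ℝ) ^ P.d * (((P.L : ℝ) ^ P.d) ^ (j + 1))⁻¹ := by
    rw [pow_succ, mul_inv]; field_simp
  calc (((P.L : ℝ) ^ P.d) ^ j)⁻¹ * ∑ x ∈ iterBlock j z, ‖N x‖ ^ 2
      ≤ (((P.L : ℝ) ^ P.d) ^ j)⁻¹ * ∑ x ∈ iterBlock (j + 1) y, ‖N x‖ ^ 2 := mul_le_mul_of_nonneg_left hsub (by positivity)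
    _ = (P.L : ℝ) ^ P.d * ((((P.L : ℝ) ^ P.d) ^ (j + 1))⁻¹ * ∑ x ∈ iterBlock (j + 1) y, ‖N x‖ ^ 2) := by rw [hscal, mul_assoc]
    _ ≤ S ^ 2 * ((((P.L : ℝ) ^ P.d) ^ (j + 1))⁻¹ * ∑ x ∈ iterBlock (j + 1) y, ‖N x‖ ^ 2) := mul_le_mul_of_nonneg_right hLS (by positivity)

omit [NormedAlgebra ℂ 𝔸] [CompleteSpace 𝔸] in
/-- the `Idx`-sum of a function of the offset alone is `|Perm|²` times the offset sum. [cite: Balaban1987RG1, (0.4) p.253] -/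
theorem sum_idx_fst_real (a : (Fin P.d → Fin P.L) → ℝ) :
    ∑ i : Idx P, a i.1 = ((Fintype.card (Equiv.Perm (Fin P.d)) * Fintype.card (Equiv.Perm (Fin P.d)) : ℕ) : ℝ) * ∑ r, a r := by
  rw [Fintype.sum_prod_type]
  simp only [Finset.sum_const, Finset.card_univ, Fintype.card_prod, nsmul_eq_mul]
  rw [← Finset.mul_sum]

omit [NormedAlgebra ℂ 𝔸] [CompleteSpace 𝔸] in
/-- `|Idx P| = L^d·|Perm|²`, in `ℝ`. [cite: Balaban1987RG1, (0.4) p.253] -/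
theorem card_idx_real : (Fintype.card (Idx P) : ℝ) = (P.L : ℝ) ^ P.d * ((Fintype.card (Equiv.Perm (Fin P.d)) * Fintype.card (Equiv.Perm (Fin P.d)) : ℕ) : ℝ) := by
  have hc : Fintype.card (Idx P) = P.L ^ P.d * (Fintype.card (Equiv.Perm (Fin P.d)) * Fintype.card (Equiv.Perm (Fin P.d))) := by
    rw [Fintype.card_prod, Fintype.card_prod, Fintype.card_fun, Fintype.card_fin, Fintype.card_fin]
  rw [hc]; push_cast; ring

omit [NormedAlgebra ℂ 𝔸] [CompleteSpace 𝔸] in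
/-- the `Idx`-mean of a function of the offset is the offset mean. [cite: Balaban1987RG1, (0.4) p.253] -/
theorem idxMean_eq_offsetMean (a : (Fin P.d → Fin P.L) → ℝ) :
    (Fintype.card (Idx P) : ℝ)⁻¹ * ∑ i : Idx P, a i.1 = ((P.L : ℝ) ^ P.d)⁻¹ * ∑ r, a r := by
  have hp0 : (0 : ℝ) < ((Fintype.card (Equiv.Perm (Fin P.d)) * Fintype.card (Equiv.Perm (Fin P.d)) : ℕ) : ℝ) := by
    have : 0 < Fintype.card (Equiv.Perm (Fin P.d)) := Fintype.card_pos
    positivity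
  rw [sum_idx_fst_real, card_idx_real, mul_inv, mul_assoc, ← mul_assoc (((Fintype.card (Equiv.Perm (Fin P.d)) * Fintype.card (Equiv.Perm (Fin P.d)) : ℕ) : ℝ))⁻¹,
    inv_mul_cancel₀ hp0.ne', one_mul]

omit [NormedAlgebra ℂ 𝔸] [CompleteSpace 𝔸] in
/-- AM ≤ QM over the offsets: `((L^d)⁻¹Σ_r a_r)² ≤ (L^d)⁻¹Σ_r a_r²` (✓`sq_sum_le_card_mul_sum_sq`). [folklore] -/
theorem sq_offsetMean_le (a : (Fin P.d → Fin P.L) → ℝ) :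
    (((P.L : ℝ) ^ P.d)⁻¹ * ∑ r, a r) ^ 2 ≤ ((P.L : ℝ) ^ P.d)⁻¹ * ∑ r, a r ^ 2 := by
  have hL : (0 : ℝ) < (P.L : ℝ) ^ P.d := by have := P.L_pos; positivity
  have h := sq_sum_le_card_mul_sum_sq (s := (Finset.univ : Finset (Fin P.d → Fin P.L))) (f := a)
  have hcR : ((Finset.univ : Finset (Fin P.d → Fin P.L)).card : ℝ) = (P.L : ℝ) ^ P.d := by
    rw [Finset.card_univ, Fintype.card_fun, Fintype.card_fin, Fintype.card_fin]; push_cast; ring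
  rw [hcR] at h
  calc (((P.L : ℝ) ^ P.d)⁻¹ * ∑ r, a r) ^ 2 = (((P.L : ℝ) ^ P.d)⁻¹) ^ 2 * (∑ r, a r) ^ 2 := by ring
    _ ≤ (((P.L : ℝ) ^ P.d)⁻¹) ^ 2 * ((P.L : ℝ) ^ P.d * ∑ r, a r ^ 2) := mul_le_mul_of_nonneg_left h (by positivity)
    _ = ((P.L : ℝ) ^ P.d)⁻¹ * ∑ r, a r ^ 2 := by field_simp

omit [NormedAlgebra ℂ 𝔸] [CompleteSpace 𝔸] in
/-- (F2) the block RMS is SUPER-AVERAGING: the `Idx`-mean of the sub-blocks' RMS is at most the block's RMS (the `Idx`-mean is the offset mean, ✓`sum_block`; AM ≤ QM).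
[cite: Balaban1984PropagatorsI, (1.16)-(1.18) p.20; Balaban1985Averaging, (97) p.32] -/
theorem mean_blockRMS_le {j : ℕ} (hj : j + 1 ≤ P.m + P.K) (N : Site P 0 → 𝔸) (y : Site P (j + 1)) :
    (Fintype.card (Idx P) : ℝ)⁻¹ * ∑ i : Idx P, Real.sqrt ((((P.L : ℝ) ^ P.d) ^ j)⁻¹ * ∑ x ∈ iterBlock j (Site.blockSite y i.1), ‖N x‖ ^ 2)
      ≤ Real.sqrt ((((P.L : ℝ) ^ P.d) ^ (j + 1))⁻¹ * ∑ x ∈ iterBlock (j + 1) y, ‖N x‖ ^ 2) := by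
  have hL : (0 : ℝ) < (P.L : ℝ) ^ P.d := by have := P.L_pos; positivity
  rw [idxMean_eq_offsetMean (fun r => Real.sqrt ((((P.L : ℝ) ^ P.d) ^ j)⁻¹ * ∑ x ∈ iterBlock j (Site.blockSite y r), ‖N x‖ ^ 2))]
  have hY : (((P.L : ℝ) ^ P.d) ^ (j + 1))⁻¹ * ∑ x ∈ iterBlock (j + 1) y, ‖N x‖ ^ 2
      = ((P.L : ℝ) ^ P.d)⁻¹ * ∑ r : Fin P.d → Fin P.L, (Real.sqrt ((((P.L : ℝ) ^ P.d) ^ j)⁻¹ * ∑ x ∈ iterBlock j (Site.blockSite y r), ‖N x‖ ^ 2)) ^ 2 := by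
    rw [sum_iterBlock_succ, sum_block hj, pow_succ, mul_inv, mul_comm ((((P.L : ℝ) ^ P.d) ^ j)⁻¹), mul_assoc, Finset.mul_sum, Finset.mul_sum, Finset.mul_sum]
    refine Finset.sum_congr rfl fun r _ => ?_
    rw [Real.sq_sqrt (by positivity)]
  rw [hY]
  exact (Real.le_sqrt (by positivity) (by positivity)).2 (sq_offsetMean_le _)

omit [NormedAlgebra ℂ 𝔸] [CompleteSpace 𝔸] in
/-- from the pointwise block-RMS bound to the SQUARED-SUM (coarse `ℓ²` against fine `ℓ²`) bound: if `‖m z‖ ≤ ε·RMS_k(N)(z)` at every level-`k` site then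
`Σ_z ‖m z‖² ≤ ε²·(L^d)^{−k}·Σ_x ‖N x‖²` (the level-`k` blocks partition the finest lattice, ✓`Finset.sum_fiberwise`). [cite: Balaban1984PropagatorsI, (1.18) p.20; Balaban1985BackgroundPropagators, (3.11) p.392] -/
theorem sum_normSq_le_of_blockRMS {k : ℕ} (N : Site P 0 → 𝔸) (m : Site P k → 𝔸) {ε : ℝ}
    (hm : ∀ z : Site P k, ‖m z‖ ≤ ε * Real.sqrt ((((P.L : ℝ) ^ P.d) ^ k)⁻¹ * ∑ x ∈ iterBlock k z, ‖N x‖ ^ 2)) :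
    ∑ z : Site P k, ‖m z‖ ^ 2 ≤ ε ^ 2 * ((((P.L : ℝ) ^ P.d) ^ k)⁻¹ * ∑ x : Site P 0, ‖N x‖ ^ 2) := by
  have hL : (0 : ℝ) < (P.L : ℝ) ^ P.d := by have := P.L_pos; positivity
  have hpart : ∑ z : Site P k, ∑ x ∈ iterBlock k z, ‖N x‖ ^ 2 = ∑ x : Site P 0, ‖N x‖ ^ 2 :=
    Finset.sum_fiberwise (Finset.univ : Finset (Site P 0)) (iterBlockOf k) (fun x => ‖N x‖ ^ 2)
  calc ∑ z : Site P k, ‖m z‖ ^ 2 ≤ ∑ z : Site P k, ε ^ 2 * ((((P.L : ℝ) ^ P.d) ^ k)⁻¹ * ∑ x ∈ iterBlock k z, ‖N x‖ ^ 2) := by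
        refine Finset.sum_le_sum fun z _ => ?_
        have h1 := hm z
        have h2 : 0 ≤ (((P.L : ℝ) ^ P.d) ^ k)⁻¹ * ∑ x ∈ iterBlock k z, ‖N x‖ ^ 2 := by positivity
        calc ‖m z‖ ^ 2 ≤ (ε * Real.sqrt ((((P.L : ℝ) ^ P.d) ^ k)⁻¹ * ∑ x ∈ iterBlock k z, ‖N x‖ ^ 2)) ^ 2 :=
              pow_le_pow_left₀ (norm_nonneg _) h1 2
          _ = ε ^ 2 * ((((P.L : ℝ) ^ P.d) ^ k)⁻¹ * ∑ x ∈ iterBlock k z, ‖N x‖ ^ 2) := by rw [mul_pow, Real.sq_sqrt h2]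
    _ = ε ^ 2 * ((((P.L : ℝ) ^ P.d) ^ k)⁻¹ * ∑ x : Site P 0, ‖N x‖ ^ 2) := by
        rw [← Finset.mul_sum, ← Finset.mul_sum, hpart]

end Packaging

end Summit.QuantumFields.YangMills.Theorems.Prop7FrameCorrectedMinusMean

end
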